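import Mathlib
import Summits.ResolutionOfSingularities.ResolutionOfSingularities.Theorems.TropicalLinksInductiveStepExtIdealPresentation

/-!
# TropicalLinks / SchonResolves — the extended evaluation and its kernel

Route `ResolutionOfSingularities/TropicalLinks`, crux `SchonResolves` (stmt-ResolutionOfSingularities-17234),
line `zariski-toric-closure`, stub `stub_extKernel` (C-glue).

For fields `k ⊆ K`, a `k`-algebra map `ev : R := k[ℤ^M] → K` (the coordinates of a very affine chart,
`I := ker ev`) and Laurent polynomials `G₁ … G_m ∈ R` with `ev (G_j) ≠ 0`, the route re-embeds the
principal open `U[G⁻¹]` into `𝔾_m^(M+m)` by the graph of the units `G_j`: with the lattice embedding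
`ι : R → S := k[ℤ^(M+m)]`, `x^v ↦ x^(v,0)`, and `y_j := x^(0,e_j)`, the extended ideal is
`I' := ⟨ι(I), y_j − ι(G_j)⟩`.  We produce the extended evaluation `ev' : S →ₐ[k] K` with
`ev' ∘ ι = ev`, `ev' (y_j) = ev (G_j)` and **`ker ev' = I'` exactly**.

Proof: by `tropicalLinks_extIdeal_presentation`, `S ⧸ I' ≃ₐ[k] (R ⧸ I)[(∏ G_j)⁻¹]`; the injection
`R ⧸ I ↪ K` induced by `ev` extends to the localization (the `ev (G_j)` are units of the field `K`)
and stays injective there, and `ev'` is the composite `S → S ⧸ I' ≃ (R ⧸ I)[(∏ G_j)⁻¹] ↪ K`.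
-/

-- single-problem summit: the doubled namespace component `ResolutionOfSingularities` is forced
set_option linter.dupNamespace false

namespace Summit.ResolutionOfSingularities.ResolutionOfSingularities.Theorems

open AddMonoidAlgebra

-- a 2 kB inlined statement (route terms, no auxiliary definitions allowed in Theorems/)
set_option maxHeartbeats 400000 in
/-- **The extended evaluation and its kernel.** For fields `k ⊆ K`, a `k`-algebra map
`ev : k[ℤ^M] →ₐ[k] K` and Laurent polynomials `G : Fin m → k[ℤ^M]` with `G j ∉ ker ev`, there is a
`k`-algebra map `ev' : k[ℤ^(M+m)] →ₐ[k] K` extending `ev` along the route's lattice embedding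
`ι f = ofCoeff (f.coeff.mapDomain (v ↦ (v,0)))`, sending `y_j = x^(0,e_j)` to `ev (G j)`, and whose
kernel is exactly the route's extended ideal `⟨ι(ker ev), y_j − ι(G_j)⟩`. [folklore] -/
theorem stub_extKernel :
    ∀ (k : Type) [Field k] (K : Type) [Field K] [Algebra k K] (M m : ℕ) (ev : AddMonoidAlgebra k (Fin M → ℤ) →ₐ[k] K) (G : Fin m → AddMonoidAlgebra k (Fin M → ℤ)), (∀ j, G j ∉ RingHom.ker ev.toRingHom) → ∃ ev' : AddMonoidAlgebra k (Fin (M + m) → ℤ) →ₐ[k] K, (∀ f : AddMonoidAlgebra k (Fin M → ℤ), ev' (AddMonoidAlgebra.ofCoeff (f.coeff.mapDomain fun v => Fin.append v (0 : Fin m → ℤ))) = ev f) ∧ (∀ j : Fin m, ev' (AddMonoidAlgebra.single (Fin.append (0 : Fin M → ℤ) (Pi.single j (1 : ℤ))) (1 : k)) = ev (G j)) ∧ RingHom.ker ev'.toRingHom = Ideal.span ((fun f : AddMonoidAlgebra k (Fin M → ℤ) => (AddMonoidAlgebra.ofCoeff (f.coeff.mapDomain fun v => Fin.append v (0 : Fin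 m → ℤ)) : AddMonoidAlgebra k (Fin (M + m) → ℤ))) '' (↑(RingHom.ker ev.toRingHom) : Set (AddMonoidAlgebra k (Fin M → ℤ))) ∪ Set.range (fun j : Fin m => AddMonoidAlgebra.single (Fin.append (0 : Fin M → ℤ) (Pi.single j (1 : ℤ))) (1 : k) - AddMonoidAlgebra.ofCoeff ((G j).coeff.mapDomain fun v => Fin.append v (0 : Fin m → ℤ)))) := by
  intro k _ K _ _ M m ev G hG
  classical
  -- the presentation `S ⧸ I' ≃ₐ[k] (R ⧸ I)[(∏ G_j)⁻¹]` of the principal open, with `I := ker ev`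
  have hpres := tropicalLinks_extIdeal_presentation k M m (RingHom.ker ev.toRingHom) G _ rfl
  -- the generating set `T` of `I'` is made opaque (only `hT` knows its definition)
  generalize hT : ((fun f : AddMonoidAlgebra k (Fin M → ℤ) => (AddMonoidAlgebra.ofCoeff (f.coeff.mapDomain fun v => Fin.append v (0 : Fin m → ℤ)) : AddMonoidAlgebra k (Fin (M + m) → ℤ))) '' (↑(RingHom.ker ev.toRingHom) : Set (AddMonoidAlgebra k (Fin M → ℤ))) ∪ Set.range (fun j : Fin m => AddMonoidAlgebra.single (Fin.append (0 : Fin M → ℤ) (Pi.single j (1 : ℤ))) (1 : k) - AddMonoidAlgebra.ofCoeff ((G j).coeff.mapDomain fun v => Fin.append v (0 : Fin m → ℤ)))) = T at hpres ⊢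
  -- `I := ker ev` is made opaque as well (only `hI` knows its definition)
  generalize hI : RingHom.ker ev.toRingHom = I at hG hpres
  obtain ⟨e, he1, he2⟩ := hpres
  -- the injection `R ⧸ I ↪ K` induced by `ev`
  have hIev : ∀ a ∈ I, ev a = 0 := fun a ha => by
    rw [← hI] at ha
    exact RingHom.mem_ker.mp ha
  let g : (AddMonoidAlgebra k (Fin M → ℤ) ⧸ I) →ₐ[k] K := Ideal.Quotient.liftₐ I ev hIev
  have hg : ∀ f, g (Ideal.Quotient.mk I f) = ev f := fun f => rfl
  clear_value g
  have hginj : Function.Injective g := by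
    rw [injective_iff_map_eq_zero]
    intro a ha
    obtain ⟨a, rfl⟩ := Ideal.Quotient.mk_surjective a
    rw [hg] at ha
    refine Ideal.Quotient.eq_zero_iff_mem.mpr ?_
    rw [← hI]
    exact RingHom.mem_ker.mpr ha
  -- the `G_j` are sent to units of the field `K`, so `g` extends to the localization
  have hGne : ∀ j, ev (G j) ≠ 0 := fun j h => hG j (by rw [← hI]; exact RingHom.mem_ker.mpr h)
  have hunit : ∀ y : Submonoid.powers (Ideal.Quotient.mk I (∏ j, G j)), IsUnit (g y) := by
    rintro ⟨y, n, rfl⟩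
    rw [map_pow]
    refine IsUnit.pow _ ?_
    rw [map_prod, map_prod, IsUnit.prod_univ_iff]
    intro j
    rw [hg]
    exact isUnit_iff_ne_zero.mpr (hGne j)
  let ψ : Localization.Away (Ideal.Quotient.mk I (∏ j, G j)) →ₐ[k] K :=
    IsLocalization.liftAlgHom (M := Submonoid.powers (Ideal.Quotient.mk I (∏ j, G j))) (f := g) hunit
  have hψ : ∀ a : AddMonoidAlgebra k (Fin M → ℤ) ⧸ I,
      ψ (algebraMap (AddMonoidAlgebra k (Fin M → ℤ) ⧸ I) (Localization.Away (Ideal.Quotient.mk I (∏ j, G j))) a) =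
        g a := fun a => by
    rw [IsLocalization.liftAlgHom_apply, IsLocalization.lift_eq]
    rfl
  clear_value ψ
  -- the extension stays injective
  have hψinj : Function.Injective ψ := by
    rw [injective_iff_map_eq_zero]
    intro z hz
    obtain ⟨a, s, rfl⟩ :=
      IsLocalization.exists_mk'_eq (Submonoid.powers (Ideal.Quotient.mk I (∏ j, G j))) z
    have h1 : ψ (IsLocalization.mk' (Localization.Away (Ideal.Quotient.mk I (∏ j, G j))) a s) *
        ψ (algebraMap (AddMonoidAlgebra k (Fin M → ℤ) ⧸ I) (Localization.Away (Ideal.Quotient.mk I (∏ j, G j))) s) =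
        ψ (algebraMap (AddMonoidAlgebra k (Fin M → ℤ) ⧸ I) (Localization.Away (Ideal.Quotient.mk I (∏ j, G j))) a) := by
      rw [← map_mul, IsLocalization.mk'_spec]
    rw [hz, zero_mul, hψ] at h1
    have ha : a = 0 := hginj (by rw [map_zero]; exact h1.symm)
    rw [ha, IsLocalization.mk'_zero]
  -- the extended evaluation: `S → S ⧸ I' ≃ (R ⧸ I)[(∏ G_j)⁻¹] ↪ K`
  refine ⟨ψ.comp ((e : _ →ₐ[k] Localization.Away (Ideal.Quotient.mk I (∏ j, G j))).comp
    (Ideal.Quotient.mkₐ k (Ideal.span T))), fun f => ?_, fun j => ?_, ?_⟩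
  · show ψ (e (Ideal.Quotient.mk (Ideal.span T) _)) = _
    rw [he1, hψ, hg]
  · show ψ (e (Ideal.Quotient.mk (Ideal.span T) _)) = _
    rw [he2, hψ, hg]
  · ext s
    rw [RingHom.mem_ker]
    show ψ (e (Ideal.Quotient.mk (Ideal.span T) s)) = 0 ↔ _
    rw [map_eq_zero_iff ψ hψinj, map_eq_zero_iff e e.injective, Ideal.Quotient.eq_zero_iff_mem]

end Summit.ResolutionOfSingularities.ResolutionOfSingularities.Theorems
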